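import Summits.QuantumFields.YangMills.Theorems.UnitScaleTiltProp7NestedMeanTowerClosenessT3
import HarnessLib

/-!
# Route `UnitScaleTilt`, crux «MinimiserStabilityRegPr» (stmt-QuantumFields-19200, stub EX), positivity block, pen (b1)-(iv) «TOWER-vs-CORNER TRANSPORTS» —
# FILE 1∕2: TRANSPORT CLOSENESS ON THE DOUBLE BLOCK (kinematics of the (R-C) remainder of the 20520 [RP]-curved lane, typed once here; 20520 consumers cite by name)

Cell `ym3-torus` (rung R3 — YM₃ on T³; NOT d = 4, NOT the Clay problem).  Width seat `ym-routeR-w4` g25 (named by w7-19200 g10 2026-08-29 21:13:16Z under ★★OWNER WORD 52).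
THEOREMS ONLY (0 `def`, 0 `sorry`); `--supports stmt-QuantumFields-19200 --as helper`; count-neutral.
THE POINT.  The (iv) row compares, on each top-level bond `c = ⟨y, μ⟩`, the CORNER tree-word tube sum `T^{str}_W A(c)` (✓`Prop7TransverseRowOfQTwSTubeComparison`) with the ITERATED
covariant stair∕line means `S_k(c)` of ✓`Prop7TrueLinIterDefect`; both live on the DOUBLE block `D = B^k(y) ∪ B^k(y + e_μ)`.  Letters on `D`, generalising
✓`Prop7NestedMeanTowerCloseness` §1–§2 (one block, staircases): §1 straight runs (`runSite (x + e_μ) μ s = runSite x μ (s+1)`, the steps of `walk x (μ⁺)^t`, the unrolling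
`Y_V([x, x + te_μ]) = Σ_{s<t} Ad_{V([x,x+se_μ])}Y(x+se_μ, μ)`); §2 ★★`norm_holT_tower_gauged_sub_one_le` — ANY fine gauge `u`, ANY `S ⊂ T^{(j)}` on whose fine reads `U^{u}` is `s₀`-close
to `1`, ANY word inside `S`: `‖u(embIter j p)·Ū⁽ʲ⁾(Γ)·u(embIter j p′)⁻¹ − 1‖ ≤ |Γ|·30ℓ′Lʲs₀` ([Balaban1985Averaging] (11) ✓`emlIterU_gaugeActT` + Prop. 4 ✓`norm_emlIterU_sub_one_le_of_reads`
+ ✓`norm_holT_sub_one_le_of_walk`); §3 the double-block corner geometry with ≥ 4 blocks per direction (`rel` on `B^k(y + e_μ)` = remainder `+ L^k e_μ`, no wrap, `|·|₁ ≤ d(2L^k − 1)`,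
★`dist1_axial_corner_twoBlock_le`: fine bonds of `D` are `2d(2L^k − 1)·a₀`-close to `1` in the corner axial gauge, [Balaban1985RegularSpaces] Lemma 1 = ✓`dist1_mul_inv_le_of_axial`);
the line sites `blockSite z r + s e_μ ∈ B(z) ∪ B(z + e_μ)` are ✓`B5AveragingLocalityV1.blockOf_runSite_blockSite_or`; §4 the d = 3 member: `sitesPerDir (K−n) ≥ 4`, the two-block `hax` in `(M₂)ˣ`, the Prop-4 budget and the level sum.
HONEST SCOPE.  Kinematics over landed letters; no estimate of print; (iv), `hQcmp`, the γ-row, the print rows, EX and the crux are NOT proved here.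
References: T. Bałaban, CMP **98** (1985) 17–51 [Balaban1985Averaging] ((8)–(11) pp.18–19, Prop. 4 (134)–(135) p.38); CMP **99** (1985) 75–102 [Balaban1985RegularSpaces]
(Lemma 1 (1.25) p.79); CMP **95** (1984) 17–40 [Balaban1984PropagatorsI] ((1.6)–(1.7) p.18, (1.18) p.20); CMP **109** (1987) 249–301 [Balaban1987RG1] ((0.1)–(0.4) pp.251–253).
-/

set_option autoImplicit false

noncomputable section

open scoped BigOperators Matrix.Norms.L2Operator

namespace Summit.QuantumFields.YangMills.Theorems.Prop7TubeTransportCloseness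

open Literature.MathematicalPhysics.QuantumFieldTheory.Balaban1983to89
open Finset T4Continuum BlockAveraging BlockAveragingEMLLinearised BlockAveragingEMLLinearisedBackground LatticeFieldCalculus
open B5Eq118OneStroke (iterBlockOf iterBlock mem_iterBlock iterBlockOf_zero iterBlockOf_succ val_iterBlockOf iterBlockOf_runSite)
open B15DeterminingSets (embIter)
open B7Prop1Explicit (U1 mem_U1 norm_inv_sub_one_le treeWord l1)
open B10Eq27TorusAxialLog (holT holT_nil holT_cons_true holT_cons_false rel rel_apply axialT axialT_self gaugeActT gaugeActT_apply unitsField toUField)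
open Summit.QuantumFields.YangMills.Theorems.Prop8Chart (emlIterU holT_gaugeActT emlIterU_gaugeActT norm_emlIterU_sub_one_le_of_reads)
open Summit.QuantumFields.YangMills.Theorems.Prop7FlatHolonomy (sitesPerDir_zero_eq_mul_pow)
open Summit.QuantumFields.YangMills.Theorems.Prop7AxialGaugeSup (dist1_mul_inv_le_of_axial)
open Summit.QuantumFields.YangMills.Theorems.IterPlaqSmallAllL (axialT_gaugeActT_axialT plaqSmall_gaugeActT)
open Summit.QuantumFields.YangMills.Theorems.Prop7SymAvgTwSym (holT_mem_U1)
open Summit.QuantumFields.YangMills.Theorems.Prop7NestedMeanTowerCloseness (norm_holT_sub_one_le_of_walk)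
open Summit.QuantumFields.YangMills.Theorems.Prop7CombGauge (iterBlockOf_fibreSite)

variable {P : Params}

/-! ## §1 Straight runs -/

section Runs
variable {j : ℕ}

/-- `(x + e_μ) + s e_μ = x + (s+1) e_μ`. [cite: Balaban1984PropagatorsI, (1.7) p.18] -/
theorem runSite_shift (x : Site P j) (μ : Fin P.d) (s : ℕ) : runSite (x.shift μ) μ s = runSite x μ (s + 1) := by
  funext ν
  by_cases hν : ν = μ
  · subst hν
    simp only [runSite, Site.shift, Function.update_self]
    push_cast
    ring
  · simp only [runSite, Site.shift, Function.update_of_ne hν]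

/-- The walk of `(μ⁺)^{t+1}` from `x`: the forward step on `⟨x, μ⟩`, then the walk of `(μ⁺)^t` from `x + e_μ`. [folklore] -/
theorem walk_replicate_true_succ (x : Site P j) (μ : Fin P.d) (t : ℕ) :
    walk x (List.replicate (t + 1) (μ, true)) = ⟨⟨x, μ⟩, true⟩ :: walk (x.shift μ) (List.replicate t (μ, true)) := rfl

/-- The steps of the straight forward walk are the forward steps on the bonds `⟨x + s e_μ, μ⟩`, `s < t`. [cite: Balaban1984PropagatorsI, (1.7) p.18] -/
theorem exists_of_mem_walk_replicate_true {μ : Fin P.d} : ∀ {t : ℕ} {x : Site P j} {st : LStep P j},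
    st ∈ walk x (List.replicate t (μ, true)) → ∃ s, s < t ∧ st = ⟨⟨runSite x μ s, μ⟩, true⟩
  | 0, x, st, h => by simp [walk] at h
  | t + 1, x, st, h => by
    rw [walk_replicate_true_succ, List.mem_cons] at h
    rcases h with h | h
    · exact ⟨0, Nat.succ_pos t, by rw [h, runSite_zero]⟩
    · obtain ⟨s, hs, hst⟩ := exists_of_mem_walk_replicate_true h
      exact ⟨s + 1, by omega, by rw [hst, runSite_shift]⟩

/-- The end of the straight forward walk of `t` steps is `x + t e_μ`. [cite: Balaban1984PropagatorsI, (1.7) p.18] -/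
theorem walkEnd_replicate_true (μ : Fin P.d) : ∀ (t : ℕ) (x : Site P j), walkEnd x (List.replicate t (μ, true)) = runSite x μ t
  | 0, x => by simp [walkEnd]
  | t + 1, x => by
    show walkEnd (x.shift μ) (List.replicate t (μ, true)) = _
    rw [walkEnd_replicate_true μ t, runSite_shift]

variable {n : Type*} [Fintype n] [DecidableEq n] [Nonempty n]

/-- **UNROLLING OF THE COVARIANT SIGNED SUM ALONG A FORWARD RUN**: `Y_V([x, x + te_μ]) = Σ_{s<t} V([x, x+se_μ])·Y(x+se_μ, μ)·V([x, x+se_μ])⋆`.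
[cite: Balaban1985Averaging, (58) p.27] -/
theorem covWalkSum_walk_replicate_true (V : GaugeField P j (Matrix.specialUnitaryGroup n ℂ)) (Z : PBond P j → Matrix n n ℂ) (μ : Fin P.d) :
    ∀ (t : ℕ) (x : Site P j), covWalkSum V Z (walk x (List.replicate t (μ, true)))
      = ∑ s ∈ Finset.range t, ((holAt V (walk x (List.replicate s (μ, true))) : Matrix.specialUnitaryGroup n ℂ) : Matrix n n ℂ)
          * Z ⟨runSite x μ s, μ⟩ * star ((holAt V (walk x (List.replicate s (μ, true))) : Matrix.specialUnitaryGroup n ℂ) : Matrix n n ℂ)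
  | 0, x => by simp [walk]
  | t + 1, x => by
    rw [walk_replicate_true_succ, covWalkSum_cons, covWalkSum_walk_replicate_true V Z μ t (x.shift μ), Finset.sum_range_succ']
    have hcs : covStep V Z ⟨⟨x, μ⟩, true⟩ = Z ⟨x, μ⟩ := by simp [covStep]
    have hsf : stepFactor V ⟨⟨x, μ⟩, true⟩ = ((V ⟨x, μ⟩ : Matrix.specialUnitaryGroup n ℂ) : Matrix n n ℂ) := by simp [stepFactor]
    have h0 : ((holAt V (walk x (List.replicate 0 (μ, true))) : Matrix.specialUnitaryGroup n ℂ) : Matrix n n ℂ) = 1 := by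
      rw [List.replicate_zero, show walk x ([] : List (Letter P.d)) = [] from rfl, holAt_nil]; rfl
    have hS : ∀ s : ℕ, ((holAt V (walk x (List.replicate (s + 1) (μ, true))) : Matrix.specialUnitaryGroup n ℂ) : Matrix n n ℂ)
        = ((V ⟨x, μ⟩ : Matrix.specialUnitaryGroup n ℂ) : Matrix n n ℂ) *
          ((holAt V (walk (x.shift μ) (List.replicate s (μ, true))) : Matrix.specialUnitaryGroup n ℂ) : Matrix n n ℂ) := by
      intro s
      rw [walk_replicate_true_succ, holAt_cons]
      simp
    rw [hcs, hsf, h0, runSite_zero, one_mul, star_one, mul_one, Finset.mul_sum, Finset.sum_mul]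
    simp only [hS, runSite_shift, StarMul.star_mul, mul_assoc]
    exact add_comm _ _
end Runs

/-! ## §2 ★★ Transport closeness of the gauged tower along any walk inside a read-controlled set -/

section Tower
variable {𝔸 : Type*} [NormedRing 𝔸] [NormedAlgebra ℂ 𝔸] [CompleteSpace 𝔸] [NormOneClass 𝔸]

/-- ★★ **TRANSPORT CLOSENESS** ([Balaban1985Averaging] Prop. 4 along a walk): `U` and its `j`-th average `U1`-valued, `u` a `U1`-valued fine gauge, `S ⊂ T^{(j)}` a set of level-`j`
sites such that every fine bond whose endpoints' `j`-blocks lie in `S` is `s₀`-close to `1` after gauging by `u` (`hax`), budget `6400ℓ′²Lʲs₀ ≤ 1`; then for every word `Γ` from `p` whose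
steps have both endpoints in `S`: `‖u(embIter j p)·Ū⁽ʲ⁾(Γ)·u(embIter j (p + Γ))⁻¹ − 1‖ ≤ |Γ|·(30ℓ′Lʲs₀)`, `ℓ′ = (d+2)L` — the gauged tower `Ū⁽ʲ⁾[U^{u}] = (Ū⁽ʲ⁾U)^{u∘embIter j}`
(✓`emlIterU_gaugeActT`) is `30ℓ′Lʲs₀`-close to `1` on the bonds of `S` (✓`norm_emlIterU_sub_one_le_of_reads`) and the holonomy telescopes (✓`norm_holT_sub_one_le_of_walk`).
[cite: Balaban1985Averaging, Prop. 4 (134)-(135) p.38, (11) p.19, (97) p.32] -/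
theorem norm_holT_tower_gauged_sub_one_le {j : ℕ} (hjm : j ≤ P.m + P.K) (U : GaugeField P 0 𝔸ˣ) (hUj : ∀ b : PBond P j, emlIterU j U b ∈ U1 𝔸)
    (u : GaugeTransf P 0 𝔸ˣ) (hu : ∀ x, u x ∈ U1 𝔸) {s₀ : ℝ} (hs₀ : 0 ≤ s₀)
    (hbudget : 6400 * (((P.d + 2) * P.L : ℕ) : ℝ) ^ 2 * (P.L : ℝ) ^ j * s₀ ≤ 1)
    (S : Set (Site P j)) (hax : ∀ b : PBond P 0, iterBlockOf j b.src ∈ S → iterBlockOf j b.tgt ∈ S → ‖((gaugeActT u U b : 𝔸ˣ) : 𝔸) - 1‖ ≤ s₀)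
    (p : Site P j) (Γ : List (Letter P.d)) (hΓ : ∀ st ∈ walk p Γ, st.bond.src ∈ S ∧ st.bond.tgt ∈ S) :
    ‖((u (embIter j p) * holT (emlIterU j U) p Γ * (u (embIter j (walkEnd p Γ)))⁻¹ : 𝔸ˣ) : 𝔸) - 1‖
      ≤ Γ.length * (30 * (((P.d + 2) * P.L : ℕ) : ℝ) * (P.L : ℝ) ^ j * s₀) := by
  set W : GaugeField P 0 𝔸ˣ := gaugeActT u U with hW
  -- the `j`-th average of the gauged field is the gauged `j`-th average
  have hcovW : emlIterU j W = gaugeActT (fun z : Site P j => u (embIter j z)) (emlIterU j U) := by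
    have hcov := emlIterU_gaugeActT (fun l (z : Site P l) => u (embIter l z)) (fun _ _ => rfl) U j
    rw [hW, show gaugeActT u U = gaugeActT (fun z : Site P 0 => u (embIter 0 z)) U from rfl, hcov]
  have hWj : ∀ b : PBond P j, emlIterU j W b ∈ U1 𝔸 := fun b => by
    rw [hcovW, gaugeActT_apply]
    exact (U1 𝔸).mul_mem ((U1 𝔸).mul_mem (hu _) (hUj b)) ((U1 𝔸).inv_mem (hu _))
  have hhol : u (embIter j p) * holT (emlIterU j U) p Γ * (u (embIter j (walkEnd p Γ)))⁻¹ = holT (emlIterU j W) p Γ := by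
    rw [hcovW, holT_gaugeActT]
  have hstep : ∀ st ∈ walk p Γ, ‖((emlIterU j W st.bond : 𝔸ˣ) : 𝔸) - 1‖ ≤ 30 * (((P.d + 2) * P.L : ℕ) : ℝ) * (P.L : ℝ) ^ j * s₀ :=
    fun st hst => norm_emlIterU_sub_one_le_of_reads hjm S W hs₀ hbudget hax st.bond (hΓ st hst).1 (hΓ st hst).2
  have hc0 : 0 ≤ 30 * (((P.d + 2) * P.L : ℕ) : ℝ) * (P.L : ℝ) ^ j * s₀ := by positivity
  rw [hhol]
  exact norm_holT_sub_one_le_of_walk (emlIterU j W) hWj hc0 Γ p hstep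
end Tower

/-! ## §3 The double-block corner geometry (≥ 4 blocks per direction) -/

section TwoBlock
variable {k : ℕ}

/-- On the NEXT block `B^k(y + e_μ)` the relative position from the corner of `B^k(y)` is the label remainder shifted by `L^k e_μ` (no wrap-around with at least four
`k`-blocks per direction). [cite: Balaban1984PropagatorsI, (1.6)-(1.7) p.18; Balaban1987RG1, (0.1) p.252] -/
theorem rel_corner_apply_shift (hk : k ≤ P.m + P.K) (hN4 : 4 ≤ P.sitesPerDir k) {y : Site P k} {μ : Fin P.d} {x : Site P 0}
    (hx : iterBlockOf k x = y.shift μ) (h0 : 0 < P.L ^ k) (ν : Fin P.d) :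
    rel (Site.fibreSite 0 k y fun _ => (⟨0, h0⟩ : Fin (P.L ^ k))) x ν = (((x ν).val % P.L ^ k + (if ν = μ then P.L ^ k else 0) : ℕ) : ℤ) := by
  set N := P.sitesPerDir 0 with hN
  set Nk := P.sitesPerDir k with hNk
  have hN0 : N = Nk * P.L ^ k := by rw [hN, hNk, sitesPerDir_zero_eq_mul_pow hk]
  have hN4' : 4 * P.L ^ k ≤ N := by rw [hN0]; exact Nat.mul_le_mul_right _ hN4
  have hYv : ((y.shift μ) ν).val = (x ν).val / P.L ^ k := by rw [← hx, val_iterBlockOf k hk x ν]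
  generalize hr : (x ν).val % P.L ^ k = r
  have hdm : (x ν).val = ((y.shift μ) ν).val * P.L ^ k + r := by rw [hYv, ← hr, mul_comm]; exact (Nat.div_add_mod _ _).symm
  have hmod : r < P.L ^ k := by rw [← hr]; exact Nat.mod_lt _ h0
  -- the coarse label of `y + e_μ`, read modulo `N = Nk·L^k` after scaling by `L^k`
  have hkey : ((((y.shift μ) ν).val * P.L ^ k : ℕ) : ZMod N) = ((((y ν).val + if ν = μ then 1 else 0) * P.L ^ k : ℕ) : ZMod N) := by
    have hv : ((y.shift μ) ν).val = ((y ν).val + if ν = μ then 1 else 0) % Nk := by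
      by_cases hν : ν = μ
      · subst hν
        rw [if_pos rfl]
        show (Function.update y ν (y ν + 1) ν).val = _
        rw [Function.update_self, ZMod.val_add, ZMod.val_one_eq_one_mod, Nat.add_mod_mod]
      · rw [if_neg hν, add_zero]
        show (Function.update y μ (y μ + 1) ν).val = _
        rw [Function.update_of_ne hν, Nat.mod_eq_of_lt (ZMod.val_lt _)]
    rw [hv, ← Nat.mul_mod_mul_right, ← hN0, ZMod.natCast_mod]
  rw [rel_apply]
  apply (ZMod.valMinAbs_spec _ _).mpr
  constructor
  · have hxv : (x ν : ZMod N) = (((x ν).val : ℕ) : ZMod N) := (ZMod.natCast_zmod_val (x ν)).symm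
    have hqv : (Site.fibreSite 0 k y (fun _ => (⟨0, h0⟩ : Fin (P.L ^ k))) ν : ZMod N)
        = ((((y ν).val * P.L ^ k + ((⟨0, h0⟩ : Fin (P.L ^ k)) : ℕ)) : ℕ) : ZMod N) := rfl
    rw [Int.cast_natCast, hxv, hqv, hdm, Nat.cast_add, hkey]
    push_cast
    by_cases hν : ν = μ
    · simp only [hν, ↓reduceIte]; ring
    · simp only [hν, ↓reduceIte]; ring
  · have hr' : (r : ℤ) + 1 ≤ ((P.L ^ k : ℕ) : ℤ) := by exact_mod_cast hmod
    have h4 : 4 * ((P.L ^ k : ℕ) : ℤ) ≤ (N : ℤ) := by exact_mod_cast hN4'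
    have hr0 : (0 : ℤ) ≤ r := by positivity
    by_cases hν : ν = μ
    · simp only [hν, ↓reduceIte]
      push_cast
      constructor <;> linarith
    · simp only [hν, ↓reduceIte, add_zero]
      constructor <;> linarith

/-- `|x − corner(y)|₁ ≤ d(2L^k − 1)` on `B^k(y + e_μ)`. [cite: Balaban1984PropagatorsI, (1.7) p.18] -/
theorem l1_rel_corner_shift_le (hk : k ≤ P.m + P.K) (hN4 : 4 ≤ P.sitesPerDir k) {y : Site P k} {μ : Fin P.d} {x : Site P 0}
    (hx : iterBlockOf k x = y.shift μ) (h0 : 0 < P.L ^ k) :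
    l1 (rel (Site.fibreSite 0 k y fun _ => (⟨0, h0⟩ : Fin (P.L ^ k))) x) ≤ P.d * (2 * P.L ^ k - 1) := by
  unfold l1
  calc ∑ ν, (rel (Site.fibreSite 0 k y fun _ => (⟨0, h0⟩ : Fin (P.L ^ k))) x ν).natAbs ≤ ∑ _ν : Fin P.d, (2 * P.L ^ k - 1) :=
        Finset.sum_le_sum fun ν _ => by
          rw [rel_corner_apply_shift hk hN4 hx h0 ν, Int.natAbs_natCast]
          have := Nat.mod_lt ((x ν).val) h0
          split_ifs <;> omega
    _ = P.d * (2 * P.L ^ k - 1) := by simp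

/-- **NO WRAP-AROUND ON THE DOUBLE BLOCK**: `2((x − corner)_ν + 1) ≤ N₀` on `B^k(y + e_μ)`. [cite: Balaban1987RG1, (0.1) p.252] -/
theorem noWrap_corner_shift (hk : k ≤ P.m + P.K) (hN4 : 4 ≤ P.sitesPerDir k) {y : Site P k} {μ : Fin P.d} {x : Site P 0}
    (hx : iterBlockOf k x = y.shift μ) (h0 : 0 < P.L ^ k) (ν : Fin P.d) :
    (rel (Site.fibreSite 0 k y fun _ => (⟨0, h0⟩ : Fin (P.L ^ k))) x ν + 1) * 2 ≤ (P.sitesPerDir 0 : ℤ) := by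
  rw [rel_corner_apply_shift hk hN4 hx h0 ν]
  have hmod : (x ν).val % P.L ^ k < P.L ^ k := Nat.mod_lt _ h0
  have hN : 4 * P.L ^ k ≤ P.sitesPerDir 0 := by
    rw [sitesPerDir_zero_eq_mul_pow hk]; exact Nat.mul_le_mul_right _ hN4
  have h4 : 4 * ((P.L ^ k : ℕ) : ℤ) ≤ (P.sitesPerDir 0 : ℤ) := by exact_mod_cast hN
  generalize hr : (x ν).val % P.L ^ k = r at hmod
  have h1 : (r : ℤ) + 1 ≤ ((P.L ^ k : ℕ) : ℤ) := by exact_mod_cast hmod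
  by_cases hν : ν = μ
  · rw [if_pos hν]; push_cast; linarith
  · rw [if_neg hν, add_zero]; linarith

variable {G : Type*} [GaugeGroup G]

/-- ★ **THE BOND BOUND ON THE DOUBLE BLOCK IN THE CORNER-BASED AXIAL GAUGE** ([Balaban1985RegularSpaces] Lemma 1, flat background; ≥ 4 blocks per direction): plaquette
variables within `a₀` of `1` ⟹ in the gauge `U^{axialT U (corner y)}` every fine bond with both endpoints in `B^k(y) ∪ B^k(y + e_μ)` has `dist1 ≤ 2d(2L^k − 1)·a₀`.
[cite: Balaban1985RegularSpaces, Lemma 1 (1.25) p.79; Balaban1985Averaging, pp.24-25] -/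
theorem dist1_axial_corner_twoBlock_le (hk : k ≤ P.m + P.K) (hN4 : 4 ≤ P.sitesPerDir k) (U : GaugeField P 0 G) {a₀ : ℝ} (ha₀ : 0 < a₀)
    (hU : PlaqSmall a₀ U) (h0 : 0 < P.L ^ k) (y : Site P k) (μ : Fin P.d) (b : PBond P 0)
    (hb : iterBlockOf k b.src = y ∨ iterBlockOf k b.src = y.shift μ) (hb' : iterBlockOf k b.tgt = y ∨ iterBlockOf k b.tgt = y.shift μ) :
    dist1 (gaugeActT (axialT U (Site.fibreSite 0 k y fun _ => (⟨0, h0⟩ : Fin (P.L ^ k)))) U b)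
      ≤ 2 * ((P.d : ℝ) * (2 * (P.L : ℝ) ^ k - 1)) * a₀ := by
  set q := Site.fibreSite 0 k y (fun _ => (⟨0, h0⟩ : Fin (P.L ^ k))) with hq
  set W := gaugeActT (axialT U q) U with hW
  have hWs : PlaqSmall a₀ W := plaqSmall_gaugeActT _ hU
  have h1s : PlaqSmall a₀ (fun _ : PBond P 0 => (1 : G)) := fun p => by
    simp only [GaugeField.plaqHol, mul_one, inv_one, GaugeGroup.dist1_one]; exact ha₀
  obtain ⟨x, κ⟩ := b
  have hax : axialT W q x = axialT (fun _ : PBond P 0 => (1 : G)) q x := by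
    rw [hW, axialT_gaugeActT_axialT]; unfold axialT; rw [B10Eq27TorusAxialLog.holT_one]
  have hax' : axialT W q (x.shift κ) = axialT (fun _ : PBond P 0 => (1 : G)) q (x.shift κ) := by
    rw [hW, axialT_gaugeActT_axialT]; unfold axialT; rw [B10Eq27TorusAxialLog.holT_one]
  have hwrap : (rel q x κ + 1) * 2 ≤ (P.sitesPerDir 0 : ℤ) := by
    rcases hb with hb | hb
    · exact Prop7NestedMeanTowerCloseness.noWrap_corner hk hb h0 κ
    · exact noWrap_corner_shift hk hN4 hb h0 κ
  have h := dist1_mul_inv_le_of_axial W (fun _ : PBond P 0 => (1 : G)) ha₀.le ha₀.le hWs h1s q x κ hwrap hax hax'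
  simp only [inv_one, mul_one] at h
  refine h.trans ?_
  have hL1 : 1 ≤ P.L ^ k := h0
  have hl1 : (l1 (rel q x) : ℝ) ≤ (P.d : ℝ) * (2 * (P.L : ℝ) ^ k - 1) := by
    have hL2 : 1 ≤ 2 * P.L ^ k := by omega
    rcases hb with hb | hb
    · have h1 := Prop7NestedMeanTowerCloseness.l1_rel_corner_le hk hb h0
      have h2 : l1 (rel q x) ≤ P.d * (2 * P.L ^ k - 1) := h1.trans (Nat.mul_le_mul_left _ (by omega))
      have : ((l1 (rel q x) : ℕ) : ℝ) ≤ ((P.d * (2 * P.L ^ k - 1) : ℕ) : ℝ) := by exact_mod_cast h2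
      rw [Nat.cast_mul, Nat.cast_sub hL2, Nat.cast_mul, Nat.cast_pow, Nat.cast_one, Nat.cast_two] at this
      exact this
    · have h1 := l1_rel_corner_shift_le hk hN4 hb h0
      have : ((l1 (rel q x) : ℕ) : ℝ) ≤ ((P.d * (2 * P.L ^ k - 1) : ℕ) : ℝ) := by exact_mod_cast h1
      rw [Nat.cast_mul, Nat.cast_sub hL2, Nat.cast_mul, Nat.cast_pow, Nat.cast_one, Nat.cast_two] at this
      exact this
  have : (l1 (rel q x) : ℝ) * (a₀ + a₀) ≤ ((P.d : ℝ) * (2 * (P.L : ℝ) ^ k - 1)) * (a₀ + a₀) := mul_le_mul_of_nonneg_right hl1 (by positivity)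
  linarith

/-- **THE SITES OF A TOP-LEVEL RUN FROM A BLOCK SITE OF ORDER `k`**: for `s ≤ L^k`, `fibreSite 0 k y r + s e_μ` lies in `B^k(y)` or in `B^k(y + e_μ)` (the `k`-fold analogue of
✓`B5AveragingLocalityV1.blockOf_runSite_blockSite_or`). [cite: Balaban1984PropagatorsI, (1.18) p.20] -/
theorem iterBlockOf_runSite_fibreSite_or (hk : k ≤ P.m + P.K) (y : Site P k) (r : Fin P.d → Fin (P.L ^ k)) (μ : Fin P.d) {s : ℕ} (hs : s ≤ P.L ^ k) :
    iterBlockOf k (runSite (Site.fibreSite 0 k y r) μ s) = y ∨ iterBlockOf k (runSite (Site.fibreSite 0 k y r) μ s) = y.shift μ := by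
  have h : P.sitesPerDir 0 = P.L ^ k * P.sitesPerDir k := by rw [sitesPerDir_zero_eq_mul_pow hk, mul_comm]
  by_cases hlt : (r μ : ℕ) + s < P.L ^ k
  · left
    have heq : runSite (Site.fibreSite 0 k y r) μ s = Site.fibreSite 0 k y (Function.update r μ ⟨r μ + s, hlt⟩) := by
      funext ν
      by_cases hν : ν = μ
      · subst hν
        simp only [runSite, Site.fibreSite, Function.update_self]
        push_cast; ring
      · simp only [runSite, Site.fibreSite, Function.update_of_ne hν]
    rw [heq, iterBlockOf_fibreSite hk h]
  · right
    have hlt' : (r μ : ℕ) + s - P.L ^ k < P.L ^ k := by have := (r μ).isLt; omega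
    have heq : runSite (Site.fibreSite 0 k y r) μ s = runSite (Site.fibreSite 0 k y (Function.update r μ ⟨r μ + s - P.L ^ k, hlt'⟩)) μ (1 * P.L ^ k) := by
      funext ν
      by_cases hν : ν = μ
      · subst hν
        simp only [runSite, Site.fibreSite, Function.update_self]
        have hnat : ((r ν : ℕ) + s - P.L ^ k) + 1 * P.L ^ k = (r ν : ℕ) + s := by omega
        have hcast := congrArg (Nat.cast : ℕ → ZMod (P.sitesPerDir 0)) hnat
        push_cast at hcast ⊢
        linear_combination (-1 : ZMod (P.sitesPerDir 0)) * hcast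
      · simp only [runSite, Site.fibreSite, Function.update_of_ne hν]
    rw [heq, iterBlockOf_runSite k hk, iterBlockOf_fibreSite hk h]
    show runSite y μ (0 + 1) = y.shift μ
    rw [runSite_succ, runSite_zero]

end TwoBlock

/-! ## §4 The d = 3 member: four blocks per direction, the two-block bond bound and the Prop-4 numerics -/

section T3
open T3ContinuumYM3Torus
open T3RegularMinimiser (regThreshold regThreshold_pos)
open T3SectALandauChart (eta eta_pos bgUnits)
open Summit.QuantumFields.YangMills.Theorems.Prop7SymAvgTwSym (pow_mul_eta_eq_one pow_mul_eta_le_one regThreshold_eq_mul_eta_sq)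
open Summit.QuantumFields.YangMills.Theorems.Prop7NestedMeanTowerCloseness (coe_gaugeActT_axialT_bgUnits)

variable (F : T3Family) {n K : ℕ}

/-- **AT LEAST SIX TOP BLOCKS PER DIRECTION**: `(F.P K).sitesPerDir (K − n) = 2L^{m+n} ≥ 6 ≥ 4` (`T3Family.hm : 1 ≤ m`, `L ≥ 3`) — the double block of a top-level bond never wraps
around the torus. [cite: Balaban1985UV3, (1)-(3) p.256] -/
theorem four_le_sitesPerDir_T3 : 4 ≤ (F.P K).sitesPerDir (K - n) := by
  show 4 ≤ 2 * F.L ^ (F.m + K - (K - n))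
  have hL3 : 3 ≤ F.L := by obtain ⟨a, ha⟩ := F.hL.1; have := F.hL.2; omega
  have h1 : F.L ^ 1 ≤ F.L ^ (F.m + K - (K - n)) := Nat.pow_le_pow_right (by omega) (by have := F.hm; omega)
  rw [pow_one] at h1; omega

/-- ★ **THE TWO-BLOCK ROW `hax` AT THE CARRIER**: on `PlaqSmall (regThreshold F n K ε₀) U₀` every fine bond with both endpoints in `B^{K−n}(y) ∪ B^{K−n}(y + e_μ)` is within
`2·(3·(2L^{K−n} − 1))·ε₀η²` of `1` in the corner-based axial gauge of `B^{K−n}(y)`, read in `(M₂)ˣ`. [cite: Balaban1985RegularSpaces, Lemma 1 (1.25) p.79; Balaban1985Variational, (2) p.278] -/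
theorem norm_axialGauge_bond_sub_one_le_twoBlock_T3 {ε₀ : ℝ} (hε₀ : 0 < ε₀) (U₀ : GaugeField (F.P K) 0 (Matrix.specialUnitaryGroup (Fin 2) ℂ))
    (hU : PlaqSmall (regThreshold F n K ε₀) U₀) (y : Site (F.P K) (K - n)) (μ : Fin (F.P K).d) (b : PBond (F.P K) 0)
    (hb : iterBlockOf (K - n) b.src = y ∨ iterBlockOf (K - n) b.src = y.shift μ)
    (hb' : iterBlockOf (K - n) b.tgt = y ∨ iterBlockOf (K - n) b.tgt = y.shift μ) :
    ‖((gaugeActT (axialT (bgUnits F K U₀) (Site.fibreSite 0 (K - n) y fun _ => (⟨0, pow_pos (F.P K).L_pos (K - n)⟩ : Fin ((F.P K).L ^ (K - n)))))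
        (bgUnits F K U₀) b : (Matrix (Fin 2) (Fin 2) ℂ)ˣ) : Matrix (Fin 2) (Fin 2) ℂ) - 1‖
      ≤ 2 * ((3 : ℝ) * (2 * (F.L : ℝ) ^ (K - n) - 1)) * regThreshold F n K ε₀ := by
  have hk : K - n ≤ (F.P K).m + (F.P K).K := by show K - n ≤ F.m + K; omega
  rw [coe_gaugeActT_axialT_bgUnits, ← SU2Mean.dist1_eq_norm]
  have h := dist1_axial_corner_twoBlock_le hk (four_le_sitesPerDir_T3 F) U₀ (regThreshold_pos F hε₀) hU (pow_pos (F.P K).L_pos (K - n)) y μ b hb hb'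
  have hd : ((F.P K).d : ℝ) = 3 := by norm_num [T3Family.P_d]
  have hLL : ((F.P K).L : ℝ) = F.L := rfl
  rw [hd, hLL] at h
  exact h

/-- numerics: with `ℓ′ = 5L`, `L^{K−n}η = 1`, `Lʲη ≤ 1` and `s₀ = 2·3(2L^{K−n} − 1)·ε₀η² ≤ 12ε₀η`: the Prop-4 budget `6400ℓ′²Lʲs₀ ≤ 1` and the per-step constant
`30ℓ′Lʲs₀ ≤ 1800L·ε₀·(Lʲη)`, `j ≤ K − n`, under `10⁷L³ε₀ ≤ 1`. [cite: Balaban1985Averaging, Prop. 4 (134) p.38; Balaban1985Variational, (146) p.301] -/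
theorem budget_twoBlock_T3 {ε₀ : ℝ} (hε₀ : 0 < ε₀) (hε7 : 10 ^ 7 * (F.L : ℝ) ^ 3 * ε₀ ≤ 1) {j : ℕ} (hj : j ≤ K - n) :
    6400 * ((((F.P K).d + 2) * (F.P K).L : ℕ) : ℝ) ^ 2 * ((F.P K).L : ℝ) ^ j * (2 * ((3 : ℝ) * (2 * (F.L : ℝ) ^ (K - n) - 1)) * regThreshold F n K ε₀) ≤ 1 ∧
    30 * ((((F.P K).d + 2) * (F.P K).L : ℕ) : ℝ) * ((F.P K).L : ℝ) ^ j * (2 * ((3 : ℝ) * (2 * (F.L : ℝ) ^ (K - n) - 1)) * regThreshold F n K ε₀)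
      ≤ 1800 * (F.L : ℝ) * ε₀ * ((F.L : ℝ) ^ j * eta F n K) := by
  have hd : (F.P K).d = 3 := T3Family.P_d F K
  have hLL : ((F.P K).L : ℝ) = F.L := rfl
  have hL3 : 3 ≤ F.L := by obtain ⟨a, ha⟩ := F.hL.1; have := F.hL.2; omega
  have hL3r : (3 : ℝ) ≤ F.L := by exact_mod_cast hL3
  have hℓ : ((((F.P K).d + 2) * (F.P K).L : ℕ) : ℝ) = 5 * (F.L : ℝ) := by rw [hd, ← hLL]; push_cast; ring
  have hη : 0 < eta F n K := eta_pos F n K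
  have hx1 : (F.L : ℝ) ^ j * eta F n K ≤ 1 := pow_mul_eta_le_one F hj
  have hx0 : 0 ≤ (F.L : ℝ) ^ j * eta F n K := by positivity
  have hk1 : (F.L : ℝ) ^ (K - n) * eta F n K = 1 := pow_mul_eta_eq_one F
  have hreg : regThreshold F n K ε₀ = ε₀ * eta F n K ^ 2 := regThreshold_eq_mul_eta_sq F ε₀
  -- `(2L^k − 1)·η² ≤ 2η`, hence `Lʲ·(2L^k − 1)·η² ≤ 2·(Lʲη)`
  have hprod : ((F.L : ℝ) ^ j) * ((2 * (F.L : ℝ) ^ (K - n) - 1) * eta F n K ^ 2) ≤ 2 * ((F.L : ℝ) ^ j * eta F n K) := by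
    have h1 : (2 * (F.L : ℝ) ^ (K - n) - 1) * eta F n K ^ 2 ≤ 2 * eta F n K := by nlinarith [hη, hk1]
    nlinarith [h1, pow_nonneg (show (0:ℝ) ≤ F.L by positivity) j]
  have hLε : (F.L : ℝ) ^ 2 * ε₀ * (10 ^ 7 * F.L) ≤ 1 := by nlinarith [hε7]
  rw [hℓ, hLL, hreg]
  constructor
  · have e : 6400 * (5 * (F.L : ℝ)) ^ 2 * (F.L : ℝ) ^ j * (2 * (3 * (2 * (F.L : ℝ) ^ (K - n) - 1)) * (ε₀ * eta F n K ^ 2))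
        = 960000 * ((F.L : ℝ) ^ 2 * ε₀) * (((F.L : ℝ) ^ j) * ((2 * (F.L : ℝ) ^ (K - n) - 1) * eta F n K ^ 2)) := by ring
    rw [e]
    calc 960000 * ((F.L : ℝ) ^ 2 * ε₀) * (((F.L : ℝ) ^ j) * ((2 * (F.L : ℝ) ^ (K - n) - 1) * eta F n K ^ 2))
        ≤ 960000 * ((F.L : ℝ) ^ 2 * ε₀) * (2 * 1) := by
          refine mul_le_mul_of_nonneg_left (hprod.trans (by linarith)) (by positivity)
      _ ≤ 1 := by nlinarith
  · have e : 30 * (5 * (F.L : ℝ)) * (F.L : ℝ) ^ j * (2 * (3 * (2 * (F.L : ℝ) ^ (K - n) - 1)) * (ε₀ * eta F n K ^ 2))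
        = 900 * (F.L : ℝ) * ε₀ * (((F.L : ℝ) ^ j) * ((2 * (F.L : ℝ) ^ (K - n) - 1) * eta F n K ^ 2)) := by ring
    rw [e]
    calc 900 * (F.L : ℝ) * ε₀ * (((F.L : ℝ) ^ j) * ((2 * (F.L : ℝ) ^ (K - n) - 1) * eta F n K ^ 2))
        ≤ 900 * (F.L : ℝ) * ε₀ * (2 * ((F.L : ℝ) ^ j * eta F n K)) := mul_le_mul_of_nonneg_left hprod (by positivity)
      _ = 1800 * (F.L : ℝ) * ε₀ * ((F.L : ℝ) ^ j * eta F n K) := by ring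

/-- **THE LEVEL SUM IS L-ONLY**: `Σ_{j<K−n} c·(Lʲη) ≤ c∕2` for `c ≥ 0` (`η·Σ_{j<k}Lʲ = (1 − η)∕(L − 1) ≤ ½`). [cite: Balaban1985BackgroundPropagators, (3.19) p.393] -/
theorem sum_mul_pow_mul_eta_le_T3 {c : ℝ} (hc : 0 ≤ c) :
    ∑ j ∈ Finset.range (K - n), c * ((F.L : ℝ) ^ j * eta F n K) ≤ c / 2 := by
  have hL3 : 3 ≤ F.L := by obtain ⟨a, ha⟩ := F.hL.1; have := F.hL.2; omega
  have hL3r : (3 : ℝ) ≤ F.L := by exact_mod_cast hL3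
  have hη : 0 < eta F n K := eta_pos F n K
  have hk1 : (F.L : ℝ) ^ (K - n) * eta F n K = 1 := pow_mul_eta_eq_one F
  have hgeom : (∑ j ∈ Finset.range (K - n), (F.L : ℝ) ^ j) * ((F.L : ℝ) - 1) = (F.L : ℝ) ^ (K - n) - 1 := geom_sum_mul _ _
  have hsum : 2 * ((∑ j ∈ Finset.range (K - n), (F.L : ℝ) ^ j) * eta F n K) ≤ 1 := by
    have h1 : ((∑ j ∈ Finset.range (K - n), (F.L : ℝ) ^ j) * eta F n K) * ((F.L : ℝ) - 1) = 1 - eta F n K := by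
      calc ((∑ j ∈ Finset.range (K - n), (F.L : ℝ) ^ j) * eta F n K) * ((F.L : ℝ) - 1)
          = ((∑ j ∈ Finset.range (K - n), (F.L : ℝ) ^ j) * ((F.L : ℝ) - 1)) * eta F n K := by ring
        _ = 1 - eta F n K := by rw [hgeom, sub_mul, hk1, one_mul]
    have h0 : 0 ≤ (∑ j ∈ Finset.range (K - n), (F.L : ℝ) ^ j) * eta F n K :=
      mul_nonneg (Finset.sum_nonneg fun j _ => by positivity) hη.le
    nlinarith
  have e : ∑ j ∈ Finset.range (K - n), c * ((F.L : ℝ) ^ j * eta F n K) = c * ((∑ j ∈ Finset.range (K - n), (F.L : ℝ) ^ j) * eta F n K) := by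
    rw [Finset.sum_mul, Finset.mul_sum]
  rw [e]
  nlinarith
end T3

end Summit.QuantumFields.YangMills.Theorems.Prop7TubeTransportCloseness

end
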